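import Summits.KontsevichZagierPeriods.KontsevichZagierPeriods.Theorems.LinRedNormalFormArrangementNormalFormStubRebaseSimplePosOnePosHUDirs
import Summits.KontsevichZagierPeriods.KontsevichZagierPeriods.Theorems.LinRedNormalFormArrangementNormalFormStubRebaseSimplePosOnePosQuadChoice

/-!
# Stub `stub_rebaseSimplePosOnePos` (crux `ArrangementNormalForm`, line `janus-bands`) —
part `HUClose`: the radius of the localisation at a triple point (`B = 2`)

Towards the residue `HU` of the one-fibre rebase over the base `(x₁, x₂, y)` (Stage B of the
choices, after part `HUChoice`). Given the letters `jjL L ℓ₂`, the band `u < t < v`, the triple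
point `X` with `y`-value `Y`, the slope `q`, the level parameter `θ` and a height constant `K ≥ 0`,
some rational radius `r > 0` makes every point `z` of the box
`|x₀ − X₀| < r`, `|x₁ − X₁| < r`, `|y − Y| < K r` CLOSE to `P₀ = (X, Y)` in the sense of
`RebasePos.good_chamber` for all four quadrant directions `dirQ σ₀ σ₁ q (nuQ u v σ₀ σ₁ q θ)`:
every letter and every resultant deviates from its value at `P₀` by less than half that value
when it is non-zero, and every letter by at most `1` (`RebasePos.exists_radius`, registered as
`rebaseSimplePos_existsRadius`). Proof: a form `c` deviates by at most `‖c‖_K r`,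
`‖c‖_K = |c₀| + |c₁| + K |c₂|` (`RebasePos.abs_sub_evQ_le`), and finitely many linear
smallness conditions on `r` are met by `RebasePos.exists_small` (part `QuadChoice`).

References: M. Kontsevich, D. Zagier, *Periods* (2001), §1.2.
-/

noncomputable section

open Set MeasureTheory MvPolynomial
open Literature.NumberTheory.Transcendental Literature.ModelTheory.ExponentialFields

namespace Summit.KontsevichZagierPeriods.ArrangementNormalForm.JanusBands

namespace RebasePos

open SeparatePos

section Close

variable {m : ℕ}

/-- The weighted coefficient norm `|c₀| + |c₁| + K |c₂|` of a form, for the box `(r, r, K r)`. -/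
def normK (c : (Fin (2 + 1) → ℚ) × ℚ) (K : ℚ) : ℚ := |c.1 0| + |c.1 1| + |c.1 2| * K

/-- The norm is non-negative for `K ≥ 0`. -/
theorem normK_nonneg (c : (Fin (2 + 1) → ℚ) × ℚ) {K : ℚ} (hK : 0 ≤ K) : 0 ≤ normK c K := by
  unfold normK
  positivity

/-- **Deviation of a form on the box** `|x₀ − X₀| ≤ r`, `|x₁ − X₁| ≤ r`, `|y − Y| ≤ K r`. -/
theorem abs_sub_evQ_le (c : (Fin (2 + 1) → ℚ) × ℚ) (X : Fin 2 → ℚ) (Y K r : ℚ)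
    (z : Fin (2 + 1 + 1) → ℝ) (h0 : |z 0 - X 0| ≤ r) (h1 : |z 1 - X 1| ≤ r) (h2 : |z 2 - Y| ≤ K * r) :
    |affF 2 1 c z - (evQ c ![X 0, X 1, Y] : ℝ)| ≤ (normK c K : ℝ) * r := by
  rw [affF_sub_evQ, Fin.sum_univ_three]
  have e0 : ((![X 0, X 1, Y] : Fin (2 + 1) → ℚ) 0 : ℝ) = X 0 := by rw [vec3_zero]
  have e1 : ((![X 0, X 1, Y] : Fin (2 + 1) → ℚ) 1 : ℝ) = X 1 := by rw [vec3_one]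
  have e2 : ((![X 0, X 1, Y] : Fin (2 + 1) → ℚ) 2 : ℝ) = Y := by rw [vec3_two]
  have c0 : z (Fin.castAdd 1 (0 : Fin (2 + 1))) = z 0 := rfl
  have c1 : z (Fin.castAdd 1 (1 : Fin (2 + 1))) = z 1 := rfl
  have c2 : z (Fin.castAdd 1 (2 : Fin (2 + 1))) = z 2 := rfl
  rw [e0, e1, e2, c0, c1, c2, normK]
  push_cast
  calc |(c.1 0 : ℝ) * (z 0 - X 0) + (c.1 1 : ℝ) * (z 1 - X 1) + (c.1 2 : ℝ) * (z 2 - Y)|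
      ≤ |(c.1 0 : ℝ) * (z 0 - X 0)| + |(c.1 1 : ℝ) * (z 1 - X 1)| + |(c.1 2 : ℝ) * (z 2 - Y)| :=
        abs_add_three _ _ _
    _ = |(c.1 0 : ℝ)| * |z 0 - X 0| + |(c.1 1 : ℝ)| * |z 1 - X 1| + |(c.1 2 : ℝ)| * |z 2 - Y| := by
        rw [abs_mul, abs_mul, abs_mul]
    _ ≤ |(c.1 0 : ℝ)| * r + |(c.1 1 : ℝ)| * r + |(c.1 2 : ℝ)| * (K * r) := by
        gcongr
    _ = (|(c.1 0 : ℝ)| + |(c.1 1 : ℝ)| + |(c.1 2 : ℝ)| * K) * r := by ring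

variable (L : Fin m → (Fin 2 → ℚ) × ℚ) (ℓ₂ : (Fin 2 → ℚ) × ℚ)

/-- **The radius of the localisation.** See the module docstring. -/
theorem exists_radius (u v : (Fin (2 + 1) → ℚ) × ℚ) (X : Fin 2 → ℚ) (Y q θ K : ℚ) (hK : 0 ≤ K) :
    ∃ r : ℚ, 0 < r ∧ ∀ σ₀ σ₁ : ℚ, σ₀ * σ₀ = 1 → σ₁ * σ₁ = 1 →
      ∀ z : Fin (2 + 1 + 1) → ℝ, |z 0 - X 0| < r → |z 1 - X 1| < r → |z 2 - Y| < K * r →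
      (∀ c : (Fin (2 + 1) → ℚ) × ℚ,
        ((∃ j, c = jjL L ℓ₂ j) ∨ (∃ j j', c = resF (jjL L ℓ₂ j) (jjL L ℓ₂ j') (dirQ σ₀ σ₁ q (nuQ u v σ₀ σ₁ q θ)))) →
        evQ c ![X 0, X 1, Y] ≠ 0 →
        2 * |affF 2 1 c z - (evQ c ![X 0, X 1, Y] : ℝ)| < |(evQ c ![X 0, X 1, Y] : ℝ)|) ∧
      (∀ j, |affF 2 1 (jjL L ℓ₂ j) z - (evQ (jjL L ℓ₂ j) ![X 0, X 1, Y] : ℝ)| ≤ 1) := by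
  classical
  -- the two signs from a bit
  set sg : Fin 2 → ℚ := ![1, -1] with hsg
  have hsg_of : ∀ σ : ℚ, σ * σ = 1 → ∃ b, σ = sg b := fun σ hσ => by
    rcases mul_self_eq_one_iff.1 hσ with h | h
    · exact ⟨0, by simp [hsg, h]⟩
    · exact ⟨1, by simp [hsg, h]⟩
  -- the finite family of forms: letters and resultants for the four directions
  set F : (Fin (m + 1) ⊕ ((Fin 2 × Fin 2) × (Fin (m + 1) × Fin (m + 1)))) → (Fin (2 + 1) → ℚ) × ℚ :=
    fun k => match k with
      | Sum.inl j => jjL L ℓ₂ j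
      | Sum.inr ((b₀, b₁), (j, j')) => resF (jjL L ℓ₂ j) (jjL L ℓ₂ j') (dirQ (sg b₀) (sg b₁) q (nuQ u v (sg b₀) (sg b₁) q θ))
    with hF
  set P₀ : Fin (2 + 1) → ℚ := ![X 0, X 1, Y] with hP₀
  obtain ⟨r, hr, hrk⟩ := exists_small
    (ι := (Fin (m + 1) ⊕ ((Fin 2 × Fin 2) × (Fin (m + 1) × Fin (m + 1)))) ⊕ Fin (m + 1))
    (fun k => match k with
      | Sum.inl k => 2 * normK (F k) K
      | Sum.inr j => normK (jjL L ℓ₂ j) K)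
    (fun k => match k with
      | Sum.inl k => if evQ (F k) P₀ ≠ 0 then |evQ (F k) P₀| else 1
      | Sum.inr _ => 1)
    (fun k => by
      rcases k with k | j
      · exact mul_nonneg zero_le_two (normK_nonneg _ hK)
      · exact normK_nonneg _ hK)
    (fun k => by
      rcases k with k | j
      · by_cases h : evQ (F k) P₀ ≠ 0
        · simp only [h, ne_eq, not_false_eq_true, if_true]
          exact abs_pos.2 h
        · simp only [h, if_false]
          exact one_pos
      · exact one_pos)
  have hr' : (0 : ℝ) ≤ r := by exact_mod_cast hr.le
  refine ⟨r, hr, fun σ₀ σ₁ hσ₀ hσ₁ z h0 h1 h2 => ?_⟩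
  obtain ⟨b₀, rfl⟩ := hsg_of σ₀ hσ₀
  obtain ⟨b₁, rfl⟩ := hsg_of σ₁ hσ₁
  have hdev : ∀ c : (Fin (2 + 1) → ℚ) × ℚ, |affF 2 1 c z - (evQ c P₀ : ℝ)| ≤ (normK c K : ℝ) * r := fun c =>
    abs_sub_evQ_le c X Y K r z h0.le h1.le h2.le
  constructor
  · intro c hc h0c
    -- `c` is a member of the family
    obtain ⟨k, rfl⟩ : ∃ k, c = F k := by
      rcases hc with ⟨j, rfl⟩ | ⟨j, j', rfl⟩
      · exact ⟨Sum.inl j, rfl⟩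
      · exact ⟨Sum.inr ((b₀, b₁), (j, j')), rfl⟩
    have hk := hrk (Sum.inl k)
    simp only [h0c, ne_eq, not_false_eq_true, if_true] at hk
    have hk' : (2 * normK (F k) K : ℝ) * r < |(evQ (F k) P₀ : ℝ)| := by
      rw [← Rat.cast_abs]
      exact_mod_cast hk
    have h := hdev (F k)
    nlinarith
  · intro j
    have hk := hrk (Sum.inr j)
    simp only at hk
    have hk' : (normK (jjL L ℓ₂ j) K : ℝ) * r < 1 := by exact_mod_cast hk
    exact (hdev _).trans hk'.le

end Close

end RebasePos

/-- **Registered part of `stub_rebaseSimplePosOnePos` (line `janus-bands`): the radius of the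
localisation at a triple point** (`RebasePos.exists_radius`): some rational `r > 0` makes every
point of the box `(r, r, K r)` around `P₀ = (X, Y)` close to `P₀` in the sense of
`RebasePos.good_chamber`, for the letters `jjL L ℓ₂` and their resultants along all four
quadrant directions `dirQ σ₀ σ₁ q (nuQ u v σ₀ σ₁ q θ)`. -/
theorem rebaseSimplePos_existsRadius (m : ℕ) (L : Fin m → (Fin 2 → ℚ) × ℚ) (ℓ₂ : (Fin 2 → ℚ) × ℚ) (u v : (Fin (2 + 1) → ℚ) × ℚ) (X : Fin 2 → ℚ) (Y q θ K : ℚ) (hK : 0 ≤ K) : ∃ r : ℚ, 0 < r ∧ ∀ σ₀ σ₁ : ℚ, σ₀ * σ₀ = 1 → σ₁ * σ₁ = 1 → ∀ z : Fin (2 + 1 + 1) → ℝ, |z 0 - X 0| < r → |z 1 - X 1| < r → |z 2 - Y| < K * r → (∀ c : (Fin (2 + 1) → ℚ) × ℚ, ((∃ j, c = RebasePos.jjL L ℓ₂ j) ∨ (∃ j j', c = RebasePos.resF (RebasePos.jjL L ℓ₂ j) (RebasePos.jjL L ℓ₂ j') (RebasePos.dirQ σ₀ σ₁ q (RebasePos.nuQ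 u v σ₀ σ₁ q θ)))) → RebasePos.evQ c ![X 0, X 1, Y] ≠ 0 → 2 * |SeparatePos.affF 2 1 c z - (RebasePos.evQ c ![X 0, X 1, Y] : ℝ)| < |(RebasePos.evQ c ![X 0, X 1, Y] : ℝ)|) ∧ (∀ j, |SeparatePos.affF 2 1 (RebasePos.jjL L ℓ₂ j) z - (RebasePos.evQ (RebasePos.jjL L ℓ₂ j) ![X 0, X 1, Y] : ℝ)| ≤ 1) :=
  RebasePos.exists_radius L ℓ₂ u v X Y q θ K hK

end Summit.KontsevichZagierPeriods.ArrangementNormalForm.JanusBands
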